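import Mathlib
import Literature.Analysis.Potential.RieszEnergyLocalBound
import HarnessLib

/-!
# Thin-collar cutoff of a Riesz potential vanishing on the unit sphere

Helper file for the crux `AnomalousForcesInteraction.GaussianLimitIsFree`
(item stmt-CriticalPhenomena-2601, line `registered`, stub `stub_collar_cutoff`).

For `1/2 < Δ ≤ 1` and a real Schwartz function `w` on `ℝ³` with `tsupport w ⊆ ball 0 1` whose
Riesz potential `U_w(x) = ∫ w(y) ‖y − x‖^{-2Δ} dy` vanishes on the unit sphere, and every `η > 0`,
there are `ε > 0` and a real Schwartz `h` with

* `∬ w(x) ‖x − y‖^{-2Δ} f(y) dy dx = ∫ h f` for every Schwartz `f` supported in the open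
  `ε`-collar `thickening ε (sphere 0 1)`, and
* `∫ h² + ∫ ‖Dh‖² ≤ η`.

Proof (folklore).  `U_w = w ⋆ ‖·‖^{-2Δ}` is smooth (`HasCompactSupport.contDiff_convolution_left`
with the locally integrable kernel, `Literature.Analysis.Potential.integrableOn_rieszKernel_ball`),
so `‖DU_w‖ ≤ L` on `closedBall 0 2` and, `U_w` vanishing on the sphere, `|U_w(x)| ≤ L · |‖x‖ − 1|`
there (mean value inequality on the segment `[x, x/‖x‖]`).  The cutoff
`χ_ε(x) = θ((‖x‖² − 1)/ε)` (`θ` a fixed bump on `ℝ`, `= 1` on `[-3, 3]`, supported in `(-4, 4)`)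
is smooth, equals `1` on the `ε`-collar, is supported in `{|‖x‖ − 1| ≤ 4ε}` and has
`‖Dχ_ε‖ ≤ B/ε`; hence `h = χ_ε · U_w` is smooth with compact support
(`HasCompactSupport.toSchwartzMap`), `|h| ≤ 4Lε ≤ L`, `‖Dh‖ ≤ L + 4LB`, and `h`, `Dh` vanish off
the `5ε`-collar, whose volume tends to `0` with `ε` (`tendsto_measure_thickening_of_isClosed`,
`Measure.addHaar_sphere`).  Finally `∬ w(x)‖x − y‖^{-2Δ} f(y) = ∫ U_w f` by Fubini
(`Literature.Analysis.Potential.integrable_prod_rieszKernel`).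
-/

noncomputable section

namespace Summit.CriticalPhenomena.Ising3DConformalLimit.Cruxes.GaussianLimitIsFree.Birth

open MeasureTheory Set Filter Metric
open scoped Topology ContDiff Convolution

namespace CollarCutoff

/-- The Riesz kernel `‖z‖^{-α}`, `α < 3`, is locally integrable on `ℝ³`. [folklore] -/
theorem locallyIntegrable_rieszKernel {α : ℝ} (h3 : α < 3) :
    LocallyIntegrable (fun z : EuclideanSpace ℝ (Fin 3) => ‖z‖ ^ (-α)) volume := by
  intro x
  refine ⟨ball 0 (‖x‖ + 1), isOpen_ball.mem_nhds ?_,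
    Literature.Analysis.Potential.integrableOn_rieszKernel_ball h3 _⟩
  rw [mem_ball_zero_iff]
  linarith

/-- The Riesz potential `x ↦ ∫ w(y) ‖y − x‖^{-α} dy` of a compactly supported Schwartz function
is smooth (it is the convolution of `w` with the locally integrable kernel). [folklore] -/
theorem contDiff_rieszPotential (w : SchwartzMap (EuclideanSpace ℝ (Fin 3)) ℝ)
    (hw : HasCompactSupport ⇑w) {α : ℝ} (h3 : α < 3) {n : ℕ∞} :
    ContDiff ℝ n (fun x : EuclideanSpace ℝ (Fin 3) => ∫ y, w y * ‖y - x‖ ^ (-α)) := by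
  have h : (fun x : EuclideanSpace ℝ (Fin 3) => ∫ y, w y * ‖y - x‖ ^ (-α)) =
      (⇑w) ⋆[ContinuousLinearMap.mul ℝ ℝ, volume]
        (fun z : EuclideanSpace ℝ (Fin 3) => ‖z‖ ^ (-α)) := by
    funext x
    rw [convolution_mul]
    refine integral_congr_ae ?_
    filter_upwards with y
    rw [norm_sub_rev]
  rw [h]
  exact hw.contDiff_convolution_left _ (w.smooth n) (locallyIntegrable_rieszKernel h3)

/-- Fubini for the Riesz pairing: `∫∫ w(x)‖x − y‖^{-α} f(y) dy dx = ∫ (∫ w(x)‖x − y‖^{-α} dx) f(y) dy`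
for real Schwartz `w, f` and `0 ≤ α < 3`. [folklore] -/
theorem integral_integral_rieszKernel_swap (w f : SchwartzMap (EuclideanSpace ℝ (Fin 3)) ℝ)
    {α : ℝ} (h0 : 0 ≤ α) (h3 : α < 3) :
    ∫ x, ∫ y, w x * ‖x - y‖ ^ (-α) * f y = ∫ y, (∫ x, w x * ‖x - y‖ ^ (-α)) * f y := by
  have heq : (Function.uncurry fun x y : EuclideanSpace ℝ (Fin 3) => w x * ‖x - y‖ ^ (-α) * f y) =
      fun z => w z.1 * f z.2 * ‖z.1 - z.2‖ ^ (-α) := by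
    funext ⟨x, y⟩
    simp only [Function.uncurry_apply_pair]
    ring
  have hint : Integrable (Function.uncurry fun x y : EuclideanSpace ℝ (Fin 3) =>
      w x * ‖x - y‖ ^ (-α) * f y) (volume.prod volume) := by
    rw [heq]
    exact Literature.Analysis.Potential.integrable_prod_rieszKernel w f h0 h3
  rw [integral_integral_swap hint]
  refine integral_congr_ae ?_
  filter_upwards with y
  exact integral_mul_const (f y) _

/-- `‖x − x/‖x‖‖ = |‖x‖ − 1|` for `x ≠ 0`. [folklore] -/
theorem norm_sub_norm_inv_smul {x : EuclideanSpace ℝ (Fin 3)} (hx : x ≠ 0) :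
    ‖x - ‖x‖⁻¹ • x‖ = |‖x‖ - 1| := by
  have hn : 0 < ‖x‖ := norm_pos_iff.mpr hx
  have h1 : x - ‖x‖⁻¹ • x = (1 - ‖x‖⁻¹) • x := by rw [sub_smul, one_smul]
  have h2 : (1 - ‖x‖⁻¹) = (‖x‖ - 1) * ‖x‖⁻¹ := by field_simp
  rw [h1, norm_smul, Real.norm_eq_abs, h2, abs_mul, abs_of_pos (inv_pos.mpr hn), mul_assoc,
    inv_mul_cancel₀ hn.ne', mul_one]

/-- A `C¹` function on `ℝ³` vanishing on the unit sphere: its derivative is bounded by some `L`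
on `closedBall 0 2`, and `|U x| ≤ L · |‖x‖ − 1|` there (mean value inequality on the radial
segment). [folklore] -/
theorem exists_potential_bounds (U : EuclideanSpace ℝ (Fin 3) → ℝ) (hU : ContDiff ℝ 1 U)
    (hU0 : ∀ x : EuclideanSpace ℝ (Fin 3), ‖x‖ = 1 → U x = 0) :
    ∃ L : ℝ, 0 ≤ L ∧ (∀ x ∈ closedBall (0 : EuclideanSpace ℝ (Fin 3)) 2, ‖fderiv ℝ U x‖ ≤ L) ∧
      ∀ x ∈ closedBall (0 : EuclideanSpace ℝ (Fin 3)) 2, x ≠ 0 → |U x| ≤ L * |‖x‖ - 1| := by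
  obtain ⟨L, hL⟩ := (isCompact_closedBall (0 : EuclideanSpace ℝ (Fin 3)) 2).exists_bound_of_continuousOn
    ((hU.continuous_fderiv one_ne_zero).continuousOn)
  have hL0 : 0 ≤ L := (norm_nonneg _).trans (hL 0 (mem_closedBall_self (by norm_num)))
  refine ⟨L, hL0, hL, fun x hx hx0 => ?_⟩
  have hn : 0 < ‖x‖ := norm_pos_iff.mpr hx0
  set x' : EuclideanSpace ℝ (Fin 3) := ‖x‖⁻¹ • x with hx'
  have hx'1 : ‖x'‖ = 1 := by
    rw [hx', norm_smul, norm_inv, norm_norm, inv_mul_cancel₀ hn.ne']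
  have hx'mem : x' ∈ closedBall (0 : EuclideanSpace ℝ (Fin 3)) 2 := by
    rw [mem_closedBall, dist_zero_right, hx'1]
    norm_num
  have hdiff : ∀ y ∈ closedBall (0 : EuclideanSpace ℝ (Fin 3)) 2, DifferentiableAt ℝ U y :=
    fun y _ => (hU.differentiable one_ne_zero) y
  have h := (convex_closedBall (0 : EuclideanSpace ℝ (Fin 3)) 2).norm_image_sub_le_of_norm_fderiv_le
    hdiff hL hx'mem hx
  rw [hU0 x' hx'1, sub_zero, Real.norm_eq_abs, norm_sub_norm_inv_smul hx0] at h
  exact h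

/-- **The collar cutoff.**  There is `B ≥ 0` such that for every `0 < ε ≤ 1` there is a smooth
`χ : ℝ³ → ℝ` with `|χ| ≤ 1`, `χ = 1` on `thickening ε (sphere 0 1)`,
`tsupport χ ⊆ {x | |‖x‖ − 1| ≤ 4ε}` and `‖Dχ(x)‖ ≤ B/ε` for `‖x‖ ≤ 2`; namely
`χ(x) = θ((‖x‖² − 1)/ε)` for a fixed smooth bump `θ` on `ℝ`. [folklore] -/
theorem exists_cutoff : ∃ B : ℝ, 0 ≤ B ∧ ∀ ε : ℝ, 0 < ε → ε ≤ 1 →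
    ∃ χ : EuclideanSpace ℝ (Fin 3) → ℝ, ContDiff ℝ ∞ χ ∧ (∀ x, |χ x| ≤ 1) ∧
      (∀ x ∈ thickening ε (sphere (0 : EuclideanSpace ℝ (Fin 3)) 1), χ x = 1) ∧
      tsupport χ ⊆ {x : EuclideanSpace ℝ (Fin 3) | |‖x‖ - 1| ≤ 4 * ε} ∧
      ∀ x : EuclideanSpace ℝ (Fin 3), ‖x‖ ≤ 2 → ‖fderiv ℝ χ x‖ ≤ B / ε := by
  let θ : ContDiffBump (0 : ℝ) := ⟨3, 4, by norm_num, by norm_num⟩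
  have hθ1 : ContDiff ℝ 1 (θ : ℝ → ℝ) := θ.contDiff
  obtain ⟨B, hB⟩ := (hθ1.continuous_deriv le_rfl).bounded_above_of_compact_support
    θ.hasCompactSupport.deriv
  have hB0 : 0 ≤ B := (norm_nonneg _).trans (hB 0)
  refine ⟨4 * B, by positivity, fun ε hε hε1 => ?_⟩
  set g : EuclideanSpace ℝ (Fin 3) → ℝ := fun x => ε⁻¹ * (‖x‖ ^ 2 - 1) with hg
  have hgs : ContDiff ℝ ∞ g := contDiff_const.mul ((contDiff_norm_sq ℝ).sub contDiff_const)
  refine ⟨fun x => θ (g x), θ.contDiff.comp hgs, fun x => ?_, fun x hx => ?_, ?_, fun x hx2 => ?_⟩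
  · rw [abs_of_nonneg θ.nonneg]
    exact θ.le_one
  · obtain ⟨z, hz, hxz⟩ := mem_thickening_iff.1 hx
    rw [mem_sphere_zero_iff_norm] at hz
    have h1 : |‖x‖ - 1| < ε := by
      rw [← hz]
      exact (abs_norm_sub_norm_le x z).trans_lt (by rwa [← dist_eq_norm])
    apply θ.one_of_mem_closedBall
    rw [mem_closedBall_zero_iff, Real.norm_eq_abs]
    show |ε⁻¹ * (‖x‖ ^ 2 - 1)| ≤ 3
    rw [abs_mul, abs_of_pos (inv_pos.mpr hε), inv_mul_le_iff₀ hε]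
    have hx0 := norm_nonneg x
    have h2 := abs_lt.mp h1
    rw [abs_le]
    constructor <;> nlinarith
  · have hclosed : IsClosed {x : EuclideanSpace ℝ (Fin 3) | |‖x‖ - 1| ≤ 4 * ε} :=
      isClosed_le (continuous_norm.sub continuous_const).abs continuous_const
    refine closure_minimal (fun x hx => ?_) hclosed
    rw [Function.mem_support] at hx
    have hx' : g x ∈ Function.support (θ : ℝ → ℝ) := hx
    rw [θ.support_eq, mem_ball_zero_iff, Real.norm_eq_abs] at hx'
    change |ε⁻¹ * (‖x‖ ^ 2 - 1)| < 4 at hx'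
    rw [abs_mul, abs_of_pos (inv_pos.mpr hε), inv_mul_lt_iff₀ hε] at hx'
    show |‖x‖ - 1| ≤ 4 * ε
    have hx0 := norm_nonneg x
    have h2 := abs_lt.mp hx'
    rw [abs_le]
    constructor <;> nlinarith
  · have hgd : HasFDerivAt g (ε⁻¹ • ((2 : ℕ) • innerSL ℝ x)) x :=
      ((hasStrictFDerivAt_norm_sq x).hasFDerivAt.sub_const 1).const_mul ε⁻¹
    have hθd : HasDerivAt (θ : ℝ → ℝ) (deriv (θ : ℝ → ℝ) (g x)) (g x) :=
      ((hθ1.differentiable one_ne_zero) (g x)).hasDerivAt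
    have hχ : HasFDerivAt (fun x => θ (g x)) (deriv (θ : ℝ → ℝ) (g x) • (ε⁻¹ • ((2 : ℕ) • innerSL ℝ x))) x :=
      hθd.comp_hasFDerivAt x hgd
    rw [hχ.fderiv, norm_smul, norm_smul, Real.norm_eq_abs, Real.norm_eq_abs,
      abs_of_pos (inv_pos.mpr hε)]
    have hB' : |deriv (θ : ℝ → ℝ) (g x)| ≤ B := by
      have := hB (g x)
      rwa [Real.norm_eq_abs] at this
    have hL2 : ‖(2 : ℕ) • innerSL ℝ x‖ ≤ 2 * 2 :=
      norm_nsmul_le.trans (by rw [innerSL_apply_norm]; push_cast; linarith)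
    calc |deriv (θ : ℝ → ℝ) (g x)| * (ε⁻¹ * ‖(2 : ℕ) • innerSL ℝ x‖)
        ≤ B * (ε⁻¹ * (2 * 2)) := by
          apply mul_le_mul hB' _ (by positivity) hB0
          exact mul_le_mul_of_nonneg_left hL2 (inv_pos.mpr hε).le
      _ = 4 * B / ε := by
          field_simp
          ring

end CollarCutoff

open CollarCutoff in
/-- **Stub 3.3 (thin-collar cutoff of a potential vanishing on the sphere).**  For `1/2 < Δ ≤ 1`
and a real Schwartz `w` with `tsupport w ⊆ ball 0 1` whose Riesz potential
`U_w(x) = ∫ w(y)‖y − x‖^{-2Δ}dy` vanishes on the unit sphere: for every `η > 0` there are `ε > 0`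
and a real Schwartz `h` with `K_Δ(w, f) = ∫ h f` for every `f` supported in the open collar
`(sphere 0 1)^ε` and `∫ h² + ∫ ‖Dh‖² ≤ η`.  Mechanism: `U_w` is smooth
(`HasCompactSupport.contDiff_convolution_left` with the locally integrable kernel,
`Literature.Analysis.Potential.integrableOn_rieszKernel_ball`), so `|U_w| ≤ 4Lε` on the
`4ε`-collar by the mean value inequality; `h = χ_ε · U_w` with `χ_ε(x) = θ((‖x‖² − 1)/ε)`
(`θ` a fixed bump, `‖Dχ_ε‖ ≤ B/ε`) is smooth with compact support
(`HasCompactSupport.toSchwartzMap`), agrees with `U_w` on the `ε`-collar, `|h| ≤ L`,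
`‖Dh‖ ≤ L + 4LB`, both vanish off the `5ε`-collar whose volume tends to `0`; and
`K_Δ(w,f) = ∫ U_w f` by Fubini. [folklore] -/
theorem stub_collar_cutoff :
    ∀ Δ : ℝ, 1 / 2 < Δ → Δ ≤ 1 →
      ∀ w : SchwartzMap (EuclideanSpace ℝ (Fin 3)) ℝ,
        tsupport ⇑w ⊆ Metric.ball (0 : EuclideanSpace ℝ (Fin 3)) 1 →
        (∀ x : EuclideanSpace ℝ (Fin 3), ‖x‖ = 1 → ∫ y, w y * ‖y - x‖ ^ (-(2 * Δ)) = 0) →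
        ∀ η : ℝ, 0 < η → ∃ ε : ℝ, 0 < ε ∧ ∃ h : SchwartzMap (EuclideanSpace ℝ (Fin 3)) ℝ,
          (∀ f : SchwartzMap (EuclideanSpace ℝ (Fin 3)) ℝ,
            tsupport ⇑f ⊆ Metric.thickening ε (Metric.sphere (0 : EuclideanSpace ℝ (Fin 3)) 1) →
              ∫ x, ∫ y, w x * ‖x - y‖ ^ (-(2 * Δ)) * f y = ∫ x, h x * f x) ∧
          (∫ x, (h x) ^ 2) + (∫ x, ‖fderiv ℝ (⇑h) x‖ ^ 2) ≤ η := by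
  intro Δ hΔ1 hΔ2 w hw hU0 η hη
  have h0 : (0 : ℝ) ≤ 2 * Δ := by linarith
  have h3 : 2 * Δ < 3 := by linarith
  -- the potential and its bounds
  set U : EuclideanSpace ℝ (Fin 3) → ℝ := fun x => ∫ y, w y * ‖y - x‖ ^ (-(2 * Δ)) with hUdef
  have hwc : HasCompactSupport ⇑w :=
    IsCompact.of_isClosed_subset (isCompact_closedBall 0 1) (isClosed_tsupport _)
      (hw.trans ball_subset_closedBall)
  have hUs : ContDiff ℝ ∞ U := contDiff_rieszPotential w hwc h3
  have hU1 : ContDiff ℝ 1 U := contDiff_rieszPotential w hwc h3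
  obtain ⟨L, hL0, hL, hUL⟩ := exists_potential_bounds U hU1 hU0
  obtain ⟨B, hB0, hcut⟩ := exists_cutoff
  -- constants
  set M : ℝ := L + 4 * L * B with hM
  set C₀ : ℝ := L ^ 2 + M ^ 2 with hC₀
  have hC₀0 : 0 ≤ C₀ := by positivity
  set τ : ℝ := η / (C₀ + 1) with hτ
  have hτ0 : 0 < τ := by positivity
  -- thin collars have small volume
  set S : Set (EuclideanSpace ℝ (Fin 3)) := sphere 0 1 with hS
  have hfin : ∃ R > (0 : ℝ), volume (thickening R S) ≠ ⊤ :=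
    ⟨1, one_pos, (isBounded_sphere.thickening).measure_lt_top.ne⟩
  have hvol : Tendsto (fun r => volume (thickening r S)) (𝓝[>] 0) (𝓝 0) := by
    have := tendsto_measure_thickening_of_isClosed hfin isClosed_sphere
    rwa [hS, Measure.addHaar_sphere volume (0 : EuclideanSpace ℝ (Fin 3)) 1, ← hS] at this
  have hev : ∀ᶠ r in 𝓝[>] (0 : ℝ), volume (thickening r S) < ENNReal.ofReal τ :=
    hvol.eventually (eventually_lt_nhds (ENNReal.ofReal_pos.mpr hτ0))
  have hmem : ∀ᶠ r in 𝓝[>] (0 : ℝ), r ∈ Ioo (0 : ℝ) (1 / 2) := Ioo_mem_nhdsGT (by norm_num)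
  obtain ⟨r, hrvol, hr0, hr1⟩ := (hev.and hmem).exists
  -- ε and the cutoff
  set ε : ℝ := r / 5 with hε
  have hε0 : 0 < ε := by positivity
  have hε8 : 4 * ε ≤ 1 / 2 := by rw [hε]; linarith
  obtain ⟨χ, hχs, hχ1, hχone, hχsupp, hχd⟩ := hcut ε hε0 (by linarith)
  set T : Set (EuclideanSpace ℝ (Fin 3)) := thickening r S with hT
  have hTfin : volume T < ⊤ := hrvol.trans ENNReal.ofReal_lt_top
  have hTreal : volume.real T ≤ τ := (ENNReal.toReal_lt_of_lt_ofReal hrvol).le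
  -- geometry of the support of `χ`
  have hA : ∀ x ∈ tsupport χ, x ∈ closedBall (0 : EuclideanSpace ℝ (Fin 3)) 2 ∧ x ≠ 0 ∧
      |‖x‖ - 1| ≤ 4 * ε ∧ x ∈ T := by
    intro x hx
    have h1 : |‖x‖ - 1| ≤ 4 * ε := hχsupp hx
    have h2 := abs_le.mp h1
    have hn : 0 < ‖x‖ := by linarith
    have hx0 : x ≠ 0 := norm_pos_iff.mp hn
    refine ⟨?_, hx0, h1, ?_⟩
    · rw [mem_closedBall, dist_zero_right]
      linarith
    · rw [hT, mem_thickening_iff]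
      refine ⟨‖x‖⁻¹ • x, ?_, ?_⟩
      · rw [hS, mem_sphere_zero_iff_norm, norm_smul, norm_inv, norm_norm, inv_mul_cancel₀ hn.ne']
      · rw [dist_eq_norm, norm_sub_norm_inv_smul hx0]
        linarith
  -- the function `h`
  set hf : EuclideanSpace ℝ (Fin 3) → ℝ := fun x => χ x * U x with hhf
  have hhs : ContDiff ℝ ∞ hf := hχs.mul hUs
  have htsub : tsupport hf ⊆ tsupport χ := tsupport_mul_subset_left
  have hhc : HasCompactSupport hf :=
    IsCompact.of_isClosed_subset (isCompact_closedBall (0 : EuclideanSpace ℝ (Fin 3)) 2)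
      (isClosed_tsupport hf) (fun x hx => (hA x (htsub hx)).1)
  -- pointwise bounds
  have hUb : ∀ x ∈ tsupport χ, |U x| ≤ L * (4 * ε) := by
    intro x hx
    obtain ⟨hx2, hx0, hx1, -⟩ := hA x hx
    exact (hUL x hx2 hx0).trans (mul_le_mul_of_nonneg_left hx1 hL0)
  have hb1 : ∀ x, |hf x| ≤ L := by
    intro x
    by_cases hx : x ∈ tsupport χ
    · rw [hhf]
      show |χ x * U x| ≤ L
      rw [abs_mul]
      calc |χ x| * |U x| ≤ 1 * (L * (4 * ε)) :=
            mul_le_mul (hχ1 x) (hUb x hx) (abs_nonneg _) zero_le_one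
        _ ≤ L := by nlinarith
    · have : χ x = 0 := by
        by_contra hne
        exact hx (subset_tsupport _ (Function.mem_support.mpr hne))
      rw [hhf]
      show |χ x * U x| ≤ L
      rw [this, zero_mul, abs_zero]
      exact hL0
  have hb2 : ∀ x, ‖fderiv ℝ hf x‖ ≤ M := by
    intro x
    by_cases hx : x ∈ tsupport χ
    · obtain ⟨hx2, hx0, hx1, -⟩ := hA x hx
      have hxn : ‖x‖ ≤ 2 := by rwa [mem_closedBall, dist_zero_right] at hx2
      have hdχ : DifferentiableAt ℝ χ x := (hχs.differentiable (by simp)) x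
      have hdU : DifferentiableAt ℝ U x := (hU1.differentiable one_ne_zero) x
      rw [hhf, fderiv_fun_mul hdχ hdU]
      calc ‖χ x • fderiv ℝ U x + U x • fderiv ℝ χ x‖
          ≤ ‖χ x • fderiv ℝ U x‖ + ‖U x • fderiv ℝ χ x‖ := norm_add_le _ _
        _ = |χ x| * ‖fderiv ℝ U x‖ + |U x| * ‖fderiv ℝ χ x‖ := by
            rw [norm_smul, norm_smul, Real.norm_eq_abs, Real.norm_eq_abs]
        _ ≤ 1 * L + (L * (4 * ε)) * (B / ε) :=
            add_le_add (mul_le_mul (hχ1 x) (hL x hx2) (norm_nonneg _) zero_le_one)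
              (mul_le_mul (hUb x hx) (hχd x hxn) (norm_nonneg _) (by positivity))
        _ = M := by
            rw [hM]
            field_simp
    · have hx' : x ∉ tsupport hf := fun h' => hx (htsub h')
      have : fderiv ℝ hf x = 0 := by
        by_contra hne
        exact hx' (support_fderiv_subset ℝ (Function.mem_support.mpr hne))
      rw [this, norm_zero, hM]
      positivity
  have hzero : ∀ x, x ∉ T → hf x = 0 ∧ fderiv ℝ hf x = 0 := by
    intro x hx
    have hx' : x ∉ tsupport χ := fun h' => hx (hA x h').2.2.2
    have hx'' : x ∉ tsupport hf := fun h' => hx' (htsub h')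
    refine ⟨image_eq_zero_of_notMem_tsupport hx'', ?_⟩
    by_contra hne
    exact hx'' (support_fderiv_subset ℝ (Function.mem_support.mpr hne))
  -- conclusion
  refine ⟨ε, hε0, hhc.toSchwartzMap hhs, fun f hfsupp => ?_, ?_⟩
  · rw [integral_integral_rieszKernel_swap w f h0 h3]
    refine integral_congr_ae ?_
    filter_upwards with y
    show (∫ x, w x * ‖x - y‖ ^ (-(2 * Δ))) * f y = χ y * U y * f y
    by_cases hy : y ∈ tsupport ⇑f
    · rw [hχone y (hfsupp hy), one_mul]
    · rw [image_eq_zero_of_notMem_tsupport hy, mul_zero, mul_zero]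
  · have hcoe : ⇑(hhc.toSchwartzMap hhs) = hf := rfl
    rw [hcoe]
    have hI1 : ∫ x, (hf x) ^ 2 ≤ L ^ 2 * volume.real T := by
      rw [← setIntegral_eq_integral_of_forall_compl_eq_zero (s := T)
        (fun x hx => by rw [(hzero x hx).1]; ring)]
      refine (Real.le_norm_self _).trans (norm_setIntegral_le_of_norm_le_const hTfin fun x _ => ?_)
      rw [Real.norm_eq_abs, abs_pow]
      exact pow_le_pow_left₀ (abs_nonneg _) (hb1 x) 2
    have hI2 : ∫ x, ‖fderiv ℝ hf x‖ ^ 2 ≤ M ^ 2 * volume.real T := by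
      rw [← setIntegral_eq_integral_of_forall_compl_eq_zero (s := T)
        (fun x hx => by rw [(hzero x hx).2, norm_zero]; ring)]
      refine (Real.le_norm_self _).trans (norm_setIntegral_le_of_norm_le_const hTfin fun x _ => ?_)
      rw [Real.norm_eq_abs, abs_pow, abs_norm]
      exact pow_le_pow_left₀ (norm_nonneg _) (hb2 x) 2
    have hvT : 0 ≤ volume.real T := measureReal_nonneg
    calc (∫ x, (hf x) ^ 2) + ∫ x, ‖fderiv ℝ hf x‖ ^ 2
        ≤ L ^ 2 * volume.real T + M ^ 2 * volume.real T := add_le_add hI1 hI2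
      _ = C₀ * volume.real T := by rw [hC₀]; ring
      _ ≤ C₀ * τ := mul_le_mul_of_nonneg_left hTreal hC₀0
      _ ≤ η := by
          rw [hτ, mul_div_assoc', div_le_iff₀ (by positivity)]
          nlinarith

end Summit.CriticalPhenomena.Ising3DConformalLimit.Cruxes.GaussianLimitIsFree.Birth

end
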